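import Mathlib.Analysis.InnerProductSpace.Adjoint

/-!
# `Balaban1983to89.B9Eq349ConjugatedRangeEnergy` — T. Bałaban, *Propagators for lattice gauge theories in a background field*, Commun. Math.
# Phys. **99** (1985) 389–434 [Balaban1985BackgroundPropagators] (3.49) p. 399 with (3.19) p. 393 and (3.23)–(3.25) p. 394: **THE ENERGY OF THE
# CONJUGATED RANGE `ran A₊`, `A = G′Q̃′†`, WITHOUT INJECTIVITY — a conjugated RIGHT INVERSE `Ψ` of the averaging `Q̃′` (`Q̃′Ψ = 1`) read in the
# FORM: `‖D(A₊h)‖ ≤ (C_Ψ + 2β + √(a′m² + C_Ψβ + c))‖A₊h‖` and `‖D₊(S P S⁻¹ x)‖ ≤ 2(C_Ψ + 3β + √(a′m² + C_Ψβ + c))‖x‖`, `C_Ψ = ‖(S_B⁻¹)†(DΨQ̃′)S†‖`** —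
# the `C_g`-FREE form of `B9Eq349ConjugatedProjection` §4 (no `κ₁`, no injectivity modulus, no `‖Δ′_aΨ‖` in the bound) — route R2′ STEP B8′ S-P5(b)

statement-level skeleton of published theorems with citation tags; proofs where landed; nothing here is a claim about the Yang–Mills mass gap

CITATION HEADER (lean-in-tree rule).  Audit cell `pub-balaban`, sub-cell `t4`, BINDER row NE9; filed by NE9 formalisation-swarm leaf prover 06
(`b2b-balaban-t4-ne9-formalise-leaf-06`, gen 65) as the PORT of the NE9 crux-ideation seat's abstract KERNEL 5
`t4/ideate/NE9/lens1-NE9RangeEnergyRightInverse.lean` (t4-ne9-idea-1 gen 91, sha16 db4ff9fd79d8abee; scratch, never proposed — CREDIT: every statement and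
proof idea below is that kernel's, re-dressed def-free: §1 on plain maps verbatim, §2–§3 for `𝕜`-LINEAR maps on finite-dimensional spaces with `†` =
`LinearMap.adjoint`; the absorption step inlined; offered to this porter journal l.47788 «as INTENT-1's §4″ or a sibling letter») — the sibling of
`B9Eq349ConjugatedProjection` (kernel 3) and `B9Eq324ConjugatedFormDifference` (kernel 4).  Source READ in the held text (`paper:balaban1985-cmp99-background-propagators`,
journal page = PDF page + 388): p. 393 (3.19) («Q′ … onto»), p. 394 (3.23)–(3.25), p. 399 (3.49).

THE PRINT (verbatim).  p. 394: *«Δ′_a(U) = Δ^η_U + Q′*(U)aQ′(U) (3.24) … Rf = (I − G′Q′*(Q′G′²Q′*)⁻¹Q′G′)f, where G′ = G′(U) = (Δ′_a)⁻¹ (3.25)»*;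
p. 399: *«For the operator P = I − R we obtain … [|P(x, x′)|, |(DP)_μ(x, x′)|, …] ≤ O(1)[…]e^{−δ₀d(y,y′)} … (3.49)»*.  Print's road is the generalized
random-walk expansion; a right inverse of `Q′(U)` is NOT in print (the cell's [folklore] device, cf. `B9Eq319QprimeTowerNeumannSection`); NOTHING of
print's estimates is asserted here.

WHY (route R2′ STEP B8′ S-P5(b)).  In `B9Eq349ConjugatedProjection.norm_D_le_on_range` the injectivity modulus `C_g` of the CONJUGATED generator
`A₊` enters only through `re⟪y, H₊y⟫ = re⟪y, Q̃′†₊h⟫ ≤ ‖y‖·m·‖h‖` for `y = A₊h`.  With ANY right inverse `Ψ` of `Q̃′` and its conjugates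
`(Ψ†)₊ = S_GΨ†S⁻¹`, `Ψ₋ = S^{−†}ΨS_G†`: (a) `(Ψ†)₊Q̃′†₊ = 1`, so `h` is recovered from `y`; (b) `re⟪y, H₊y⟫ = re⟪D₋Ψ₋Q̃′₋y, D₊y⟫ + a′re⟪Q̃′₋y, Q̃′₊y⟫ ≤
C_Ψ‖y‖‖D₊y‖ + a′m²‖y‖²` by `B9Eq324ConjugatedFormDifference.inner_Hp`'s form and `Q̃′₋Ψ₋ = 1`; (c) completing the square with `‖Df‖² ≤ re⟪f,Hf⟫`,
`‖D₊ − D‖ ≤ β`, `re⟪y,(H − H₊)y⟫ ≤ 2β‖Dy‖‖y‖ + c‖y‖²` gives the bound — `κ₁` survives only in `norm_conjProj_le_two`'s RADIUS `12δ± ≤ √κ₁`.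

WHAT IS PROVED (sorry-free; proof lane — no `def`, no `Prop` placeholder; [folklore] Hilbert-space algebra over `RCLike 𝕜`; nothing of [B9] asserted).
* §1 LETTERS LEVEL (plain maps): `Qm_Psm_eq` (`Q̃′₋Ψ₋ = 1` from `(Ψ†)₊Q̃′†₊ = 1` and the two pairings), `inner_Hp_range_eq`, **`re_inner_Hp_range_le`**,
  **`norm_D_le_on_range_rinv`** (`‖D(A₊h)‖ ≤ (C_Ψ + 2β + √(a′m² + C_Ψβ + c))‖A₊h‖`), `norm_Dp_le_on_range_rinv` (`C_Ψ + 3β + √…`),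
  **`norm_conjDP_le_two_rinv`** (`‖SPS⁻¹‖ ≤ 2` taken as a LETTER — `B9Eq349ConjugatedProjection.norm_conjProj_le_two` — ⇒ `‖D₊(SPS⁻¹x)‖ ≤ 2(C_Ψ + 3β + √…)‖x‖`).
* §2 STRUCTURE (`→ₗ`, `LinearMap.adjoint`): `inner_Psm_eq` (the pairing `⟪Ψ₋g, y⟫ = ⟪g, (Ψ†)₊y⟫`), **`Psdp_Qdp_eq`** ((a) from `Q̃′Ψ = 1`, `S⁻¹S = 1`, `S_GS_G⁻¹ = 1`),
  `adjoint_apply_adjoint_of_leftInverse` (`S⁻¹S = 1 ⇒ S†(S⁻¹)† = 1`, by pairings), **`Dm_Psm_Qm_eq`** (`D₋Ψ₋Q̃′₋ = (S_B⁻¹)†(DΨQ̃′)S†` — the `C_Ψ` letter is ONE conjugated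
  local operator), `hCPsi_of_letter`.
* §3 the UNCONJUGATED corollary **`norm_D_le_on_range_unconj`** (`S = 1`, `β = c = 0`): `‖D(Ag)‖ ≤ (‖DΨQ̃′‖ + √a′·M)‖Ag‖` on `ran G′Q̃′†`.  §4 non-vacuity `example`.
HONEST SCOPE.  Symbolic; whether the tree's `Q̃′` (`B9Eq319QprimeTorus.QprimeLin` with `pathTr` contours, `c₁`-weighted) admits the bump right inverse `Ψ`
VERBATIM is the S-P5(b) porter's check — `Q̃′Ψ = 1` is a LETTER here; no lattice, no decay rate, no number; ONE device of ONE sub-step of a route step, NOT NE9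
(cell pub-balaban: NE9 NOT PRINTED ∕ NOT PROVED; «NE9 ⇐ the named binders»; spine PROVED 0∕9; rung (B)+1 on a finite T⁴ — NOT infinite volume, NOT mass gap, NOT
Clay; HONEST DEPENDENCY: continuum YM on T⁴ ⇐ BetaPertH ∧ nine spine estimates (0/9 proved); BetaPertH ⇐ (D1) ∧ (D4) ∧ CAP+tail; G-an2-4 gates asym, D1 and
NE2/3/4).  NEW file, Mathlib-only imports; nothing modified.  Net new unproved facts: 0.
-/

namespace Literature.MathematicalPhysics.QuantumFieldTheory.Balaban1983to89.B9Eq349ConjugatedRangeEnergy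

open scoped InnerProductSpace

variable {𝕜 : Type*} [RCLike 𝕜] {E : Type*} [NormedAddCommGroup E] [InnerProductSpace 𝕜 E]
  {G : Type*} [NormedAddCommGroup G] [InnerProductSpace 𝕜 G] {B : Type*} [NormedAddCommGroup B] [InnerProductSpace 𝕜 B]

/-! ## §1 Letters level: the range energy through a conjugated right inverse -/

section Letters

variable {Dop Dp Dm : E → B} {Qp Qm : E → G} {H Hp : E → E} {Ap Qdp Psm : G → E} {Psdp : E → G} {a' : ℝ}

omit [InnerProductSpace 𝕜 B] in
/-- (a) at `−κ̄`: `(Ψ†)₊Q̃′†₊ = 1` and the two adjoint pairings give `Q̃′₋Ψ₋ = 1`. [folklore] [cite: Balaban1985BackgroundPropagators, (3.19) p.393, (3.49) p.399] -/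
theorem Qm_Psm_eq (hQdp : ∀ h z, ⟪Qdp h, z⟫_𝕜 = ⟪h, Qm z⟫_𝕜) (hPs : ∀ g y, ⟪Psm g, y⟫_𝕜 = ⟪g, Psdp y⟫_𝕜) (hPsQ : ∀ h, Psdp (Qdp h) = h) (g : G) :
    Qm (Psm g) = g := by
  apply ext_inner_left 𝕜
  intro g'
  rw [← hQdp, ← inner_conj_symm, hPs, hPsQ, inner_conj_symm]

/-- (b) THE FORM OF `H₊` ON THE RANGE, `Ψ` INSERTED: for `y = A₊h`, `⟪y, H₊y⟫ = ⟪D₋Ψ₋Q̃′₋y, D₊y⟫ + a′⟪Q̃′₋y, Q̃′₊y⟫` (`Q̃′₋Ψ₋ = 1` kills the `Ψ` in the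
penalty term). [folklore] [cite: Balaban1985BackgroundPropagators, (3.24) p.394, (3.49) p.399] -/
theorem inner_Hp_range_eq (hHp : ∀ x y, ⟪x, Hp y⟫_𝕜 = ⟪Dm x, Dp y⟫_𝕜 + ((a' : ℝ) : 𝕜) * ⟪Qm x, Qp y⟫_𝕜) (hHAp : ∀ h, Hp (Ap h) = Qdp h)
    (hQdp : ∀ h z, ⟪Qdp h, z⟫_𝕜 = ⟪h, Qm z⟫_𝕜) (hPs : ∀ g y, ⟪Psm g, y⟫_𝕜 = ⟪g, Psdp y⟫_𝕜) (hPsQ : ∀ h, Psdp (Qdp h) = h) (h : G) :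
    ⟪Ap h, Hp (Ap h)⟫_𝕜 = ⟪Dm (Psm (Qm (Ap h))), Dp (Ap h)⟫_𝕜 + ((a' : ℝ) : 𝕜) * ⟪Qm (Ap h), Qp (Ap h)⟫_𝕜 := by
  have e1 : ⟪Psm (Qm (Ap h)), Hp (Ap h)⟫_𝕜 = ⟪Ap h, Hp (Ap h)⟫_𝕜 := by
    rw [hHAp, ← inner_conj_symm, hQdp, Qm_Psm_eq hQdp hPs hPsQ, ← hQdp, inner_conj_symm]
  rw [← e1, hHp, Qm_Psm_eq hQdp hPs hPsQ]

/-- (b) bounded: `re⟪y, H₊y⟫ ≤ C_Ψ‖y‖‖D₊y‖ + a′m²‖y‖²` for `y = A₊h` (`‖D₋Ψ₋Q̃′₋‖ ≤ C_Ψ`, `‖Q̃′±‖ ≤ m`). [folklore] [cite: Balaban1985BackgroundPropagators, (3.24) p.394, (3.49) p.399] -/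
theorem re_inner_Hp_range_le (hHp : ∀ x y, ⟪x, Hp y⟫_𝕜 = ⟪Dm x, Dp y⟫_𝕜 + ((a' : ℝ) : 𝕜) * ⟪Qm x, Qp y⟫_𝕜) (hHAp : ∀ h, Hp (Ap h) = Qdp h)
    (hQdp : ∀ h z, ⟪Qdp h, z⟫_𝕜 = ⟪h, Qm z⟫_𝕜) (hPs : ∀ g y, ⟪Psm g, y⟫_𝕜 = ⟪g, Psdp y⟫_𝕜) (hPsQ : ∀ h, Psdp (Qdp h) = h) (ha : 0 ≤ a')
    {CΨ m : ℝ} (hm0 : 0 ≤ m) (hCΨ : ∀ y, ‖Dm (Psm (Qm y))‖ ≤ CΨ * ‖y‖) (hmp : ∀ y, ‖Qp y‖ ≤ m * ‖y‖) (hmm : ∀ y, ‖Qm y‖ ≤ m * ‖y‖) (h : G) :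
    RCLike.re ⟪Ap h, Hp (Ap h)⟫_𝕜 ≤ CΨ * ‖Ap h‖ * ‖Dp (Ap h)‖ + a' * m ^ 2 * ‖Ap h‖ ^ 2 := by
  set y := Ap h with hy
  rw [inner_Hp_range_eq hHp hHAp hQdp hPs hPsQ h, map_add, RCLike.re_ofReal_mul]
  have h1 : RCLike.re ⟪Dm (Psm (Qm y)), Dp y⟫_𝕜 ≤ CΨ * ‖y‖ * ‖Dp y‖ := (re_inner_le_norm _ _).trans (mul_le_mul_of_nonneg_right (hCΨ y) (norm_nonneg _))
  have h2 : RCLike.re ⟪Qm y, Qp y⟫_𝕜 ≤ m ^ 2 * ‖y‖ ^ 2 := by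
    calc RCLike.re ⟪Qm y, Qp y⟫_𝕜 ≤ ‖Qm y‖ * ‖Qp y‖ := re_inner_le_norm _ _
      _ ≤ (m * ‖y‖) * (m * ‖y‖) := mul_le_mul (hmm y) (hmp y) (norm_nonneg _) (mul_nonneg hm0 (norm_nonneg _))
      _ = m ^ 2 * ‖y‖ ^ 2 := by ring
  nlinarith [h1, mul_le_mul_of_nonneg_left h2 ha]

/-- **(c) THE RANGE ENERGY WITHOUT INJECTIVITY**: `‖Df‖² ≤ re⟪f, Hf⟫`, the form of `H₊`, `H₊A₊ = Q̃′†₊`, the pairings, `(Ψ†)₊Q̃′†₊ = 1`, `‖D₋Ψ₋Q̃′₋‖ ≤ C_Ψ`,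
`‖Q̃′±‖ ≤ m`, `‖D₊ − D‖ ≤ β`, `re⟪y, (H − H₊)y⟫ ≤ 2β‖Dy‖‖y‖ + c‖y‖²` ⇒ `‖D(A₊h)‖ ≤ (C_Ψ + 2β + √(a′m² + C_Ψβ + c))·‖A₊h‖` —
`B9Eq349ConjugatedProjection.norm_D_le_on_range` with `hCg`, `hm` REPLACED. [folklore] [cite: Balaban1985BackgroundPropagators, (3.24)–(3.25) p.394, (3.49) p.399] -/
theorem norm_D_le_on_range_rinv (hHD : ∀ f, ‖Dop f‖ ^ 2 ≤ RCLike.re ⟪f, H f⟫_𝕜)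
    (hHp : ∀ x y, ⟪x, Hp y⟫_𝕜 = ⟪Dm x, Dp y⟫_𝕜 + ((a' : ℝ) : 𝕜) * ⟪Qm x, Qp y⟫_𝕜) (hHAp : ∀ h, Hp (Ap h) = Qdp h)
    (hQdp : ∀ h z, ⟪Qdp h, z⟫_𝕜 = ⟪h, Qm z⟫_𝕜) (hPs : ∀ g y, ⟪Psm g, y⟫_𝕜 = ⟪g, Psdp y⟫_𝕜) (hPsQ : ∀ h, Psdp (Qdp h) = h)
    (ha : 0 ≤ a') {CΨ m β c : ℝ} (hCΨ0 : 0 ≤ CΨ) (hm0 : 0 ≤ m) (hβ0 : 0 ≤ β) (hc0 : 0 ≤ c)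
    (hCΨ : ∀ y, ‖Dm (Psm (Qm y))‖ ≤ CΨ * ‖y‖) (hmp : ∀ y, ‖Qp y‖ ≤ m * ‖y‖) (hmm : ∀ y, ‖Qm y‖ ≤ m * ‖y‖) (hDD : ∀ f, ‖Dp f - Dop f‖ ≤ β * ‖f‖)
    (hHH : ∀ y, RCLike.re ⟪y, H y - Hp y⟫_𝕜 ≤ 2 * β * ‖Dop y‖ * ‖y‖ + c * ‖y‖ ^ 2) (h : G) :
    ‖Dop (Ap h)‖ ≤ (CΨ + 2 * β + Real.sqrt (a' * m ^ 2 + CΨ * β + c)) * ‖Ap h‖ := by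
  set y := Ap h with hy
  have e : RCLike.re ⟪y, H y⟫_𝕜 = RCLike.re ⟪y, Hp y⟫_𝕜 + RCLike.re ⟪y, H y - Hp y⟫_𝕜 := by
    rw [inner_sub_right, map_sub]; ring
  have hform := re_inner_Hp_range_le hHp hHAp hQdp hPs hPsQ ha hm0 hCΨ hmp hmm h
  have hDp : ‖Dp y‖ ≤ ‖Dop y‖ + β * ‖y‖ := by
    calc ‖Dp y‖ = ‖(Dp y - Dop y) + Dop y‖ := by rw [sub_add_cancel]
      _ ≤ ‖Dp y - Dop y‖ + ‖Dop y‖ := norm_add_le _ _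
      _ ≤ β * ‖y‖ + ‖Dop y‖ := add_le_add (hDD y) le_rfl
      _ = ‖Dop y‖ + β * ‖y‖ := by ring
  have h1 : RCLike.re ⟪y, Hp y⟫_𝕜 ≤ CΨ * ‖y‖ * (‖Dop y‖ + β * ‖y‖) + a' * m ^ 2 * ‖y‖ ^ 2 := by
    have := mul_le_mul_of_nonneg_left hDp (mul_nonneg hCΨ0 (norm_nonneg y))
    rw [← hy] at hform; linarith [hform]
  have h2 : ‖Dop y‖ ^ 2 ≤ (a' * m ^ 2 + CΨ * β + c) * ‖y‖ ^ 2 + 2 * ((CΨ + 2 * β) / 2 * ‖y‖) * ‖Dop y‖ := by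
    have h0 := hHD y
    rw [e] at h0
    nlinarith [h0, h1, hHH y]
  have hA : 0 ≤ (a' * m ^ 2 + CΨ * β + c) * ‖y‖ ^ 2 := by positivity
  have hb : 0 ≤ (CΨ + 2 * β) / 2 * ‖y‖ := by positivity
  -- the absorption `t² ≤ a + 2bt ⇒ t ≤ 2b + √a`
  have h3 : ‖Dop y‖ ≤ 2 * ((CΨ + 2 * β) / 2 * ‖y‖) + Real.sqrt ((a' * m ^ 2 + CΨ * β + c) * ‖y‖ ^ 2) := by
    set t := ‖Dop y‖ with ht
    set a := (a' * m ^ 2 + CΨ * β + c) * ‖y‖ ^ 2 with hadef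
    set b := (CΨ + 2 * β) / 2 * ‖y‖ with hbdef
    by_contra hle
    have hlt : 2 * b + Real.sqrt a < t := not_le.mp hle
    have hs2 : Real.sqrt a ^ 2 = a := Real.sq_sqrt hA
    nlinarith [mul_pos (by linarith : (0 : ℝ) < t - 2 * b - Real.sqrt a) (by linarith [Real.sqrt_nonneg a] : (0 : ℝ) < t - 2 * b + Real.sqrt a),
      mul_nonneg hb (by linarith [Real.sqrt_nonneg a] : (0 : ℝ) ≤ t - 2 * b), hs2, h2]
  rw [Real.sqrt_mul' _ (sq_nonneg _), Real.sqrt_sq (norm_nonneg _)] at h3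
  nlinarith [h3]

/-- (c′) the conjugated derivative on the range: `‖D₊(A₊h)‖ ≤ (C_Ψ + 3β + √(a′m² + C_Ψβ + c))·‖A₊h‖`. [folklore] [cite: Balaban1985BackgroundPropagators, (3.49) p.399] -/
theorem norm_Dp_le_on_range_rinv (hHD : ∀ f, ‖Dop f‖ ^ 2 ≤ RCLike.re ⟪f, H f⟫_𝕜)
    (hHp : ∀ x y, ⟪x, Hp y⟫_𝕜 = ⟪Dm x, Dp y⟫_𝕜 + ((a' : ℝ) : 𝕜) * ⟪Qm x, Qp y⟫_𝕜) (hHAp : ∀ h, Hp (Ap h) = Qdp h)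
    (hQdp : ∀ h z, ⟪Qdp h, z⟫_𝕜 = ⟪h, Qm z⟫_𝕜) (hPs : ∀ g y, ⟪Psm g, y⟫_𝕜 = ⟪g, Psdp y⟫_𝕜) (hPsQ : ∀ h, Psdp (Qdp h) = h)
    (ha : 0 ≤ a') {CΨ m β c : ℝ} (hCΨ0 : 0 ≤ CΨ) (hm0 : 0 ≤ m) (hβ0 : 0 ≤ β) (hc0 : 0 ≤ c)
    (hCΨ : ∀ y, ‖Dm (Psm (Qm y))‖ ≤ CΨ * ‖y‖) (hmp : ∀ y, ‖Qp y‖ ≤ m * ‖y‖) (hmm : ∀ y, ‖Qm y‖ ≤ m * ‖y‖) (hDD : ∀ f, ‖Dp f - Dop f‖ ≤ β * ‖f‖)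
    (hHH : ∀ y, RCLike.re ⟪y, H y - Hp y⟫_𝕜 ≤ 2 * β * ‖Dop y‖ * ‖y‖ + c * ‖y‖ ^ 2) (h : G) :
    ‖Dp (Ap h)‖ ≤ (CΨ + 3 * β + Real.sqrt (a' * m ^ 2 + CΨ * β + c)) * ‖Ap h‖ := by
  have h1 := norm_D_le_on_range_rinv hHD hHp hHAp hQdp hPs hPsQ ha hCΨ0 hm0 hβ0 hc0 hCΨ hmp hmm hDD hHH h
  calc ‖Dp (Ap h)‖ = ‖(Dp (Ap h) - Dop (Ap h)) + Dop (Ap h)‖ := by rw [sub_add_cancel]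
    _ ≤ ‖Dp (Ap h) - Dop (Ap h)‖ + ‖Dop (Ap h)‖ := norm_add_le _ _
    _ ≤ β * ‖Ap h‖ + (CΨ + 2 * β + Real.sqrt (a' * m ^ 2 + CΨ * β + c)) * ‖Ap h‖ := add_le_add (hDD _) h1
    _ = (CΨ + 3 * β + Real.sqrt (a' * m ^ 2 + CΨ * β + c)) * ‖Ap h‖ := by ring

/-- **(c″) THE CONJUGATED `D P`, `C_g`-FREE** (what S-P5(b) feeds to the Cauchy commutator step): with `‖SPS⁻¹x‖ ≤ 2‖x‖` as a LETTER
(`B9Eq349ConjugatedProjection.norm_conjProj_le_two` on `12δ± ≤ √κ₁`), `Px = A(Tx)`, `S(Ag) = A₊(Vg)`: `‖D₊(SPS⁻¹x)‖ ≤ 2(C_Ψ + 3β + √(a′m² + C_Ψβ + c))‖x‖`.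
[folklore] [cite: Balaban1985BackgroundPropagators, (3.49) p.399, (3.25) p.394] -/
theorem norm_conjDP_le_two_rinv {A : G → E} {P S Sinv : E → E} {T : E → G} {V : G → G}
    (hPA : ∀ x, P x = A (T x)) (hV : ∀ g, S (A g) = Ap (V g)) (hSPS : ∀ x, ‖S (P (Sinv x))‖ ≤ 2 * ‖x‖)
    (hHD : ∀ f, ‖Dop f‖ ^ 2 ≤ RCLike.re ⟪f, H f⟫_𝕜)
    (hHp : ∀ x y, ⟪x, Hp y⟫_𝕜 = ⟪Dm x, Dp y⟫_𝕜 + ((a' : ℝ) : 𝕜) * ⟪Qm x, Qp y⟫_𝕜) (hHAp : ∀ h, Hp (Ap h) = Qdp h)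
    (hQdp : ∀ h z, ⟪Qdp h, z⟫_𝕜 = ⟪h, Qm z⟫_𝕜) (hPs : ∀ g y, ⟪Psm g, y⟫_𝕜 = ⟪g, Psdp y⟫_𝕜) (hPsQ : ∀ h, Psdp (Qdp h) = h)
    (ha : 0 ≤ a') {CΨ m β c : ℝ} (hCΨ0 : 0 ≤ CΨ) (hm0 : 0 ≤ m) (hβ0 : 0 ≤ β) (hc0 : 0 ≤ c)
    (hCΨ : ∀ y, ‖Dm (Psm (Qm y))‖ ≤ CΨ * ‖y‖) (hmp : ∀ y, ‖Qp y‖ ≤ m * ‖y‖) (hmm : ∀ y, ‖Qm y‖ ≤ m * ‖y‖) (hDD : ∀ f, ‖Dp f - Dop f‖ ≤ β * ‖f‖)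
    (hHH : ∀ y, RCLike.re ⟪y, H y - Hp y⟫_𝕜 ≤ 2 * β * ‖Dop y‖ * ‖y‖ + c * ‖y‖ ^ 2) (x : E) :
    ‖Dp (S (P (Sinv x)))‖ ≤ 2 * (CΨ + 3 * β + Real.sqrt (a' * m ^ 2 + CΨ * β + c)) * ‖x‖ := by
  have hy : S (P (Sinv x)) = Ap (V (T (Sinv x))) := by rw [hPA, hV]
  have h1 := norm_Dp_le_on_range_rinv hHD hHp hHAp hQdp hPs hPsQ ha hCΨ0 hm0 hβ0 hc0 hCΨ hmp hmm hDD hHH (V (T (Sinv x)))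
  rw [← hy] at h1
  have hC : 0 ≤ CΨ + 3 * β + Real.sqrt (a' * m ^ 2 + CΨ * β + c) := by positivity
  calc ‖Dp (S (P (Sinv x)))‖ ≤ (CΨ + 3 * β + Real.sqrt (a' * m ^ 2 + CΨ * β + c)) * ‖S (P (Sinv x))‖ := h1
    _ ≤ (CΨ + 3 * β + Real.sqrt (a' * m ^ 2 + CΨ * β + c)) * (2 * ‖x‖) := mul_le_mul_of_nonneg_left (hSPS x) hC
    _ = 2 * (CΨ + 3 * β + Real.sqrt (a' * m ^ 2 + CΨ * β + c)) * ‖x‖ := by ring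

end Letters

/-! ## §2 Structure: the three `Ψ`-hypotheses of §1 from `Q̃′Ψ = 1` and the one-sided inverse identities -/

section Structure

variable [FiniteDimensional 𝕜 E] [FiniteDimensional 𝕜 G] [FiniteDimensional 𝕜 B]
  {D : E →ₗ[𝕜] B} {Q : E →ₗ[𝕜] G} {Ps : G →ₗ[𝕜] E} {S Sinv : E →ₗ[𝕜] E} {SB SBinv : B →ₗ[𝕜] B} {SG SGinv : G →ₗ[𝕜] G}

omit [FiniteDimensional 𝕜 B] in
/-- The pairing letter `hPs` of §1: with `(Ψ†)₊y := S_G(Ψ†(S⁻¹y))` and `Ψ₋g := (S⁻¹)†(Ψ(S_G†g))`, `⟪Ψ₋g, y⟫ = ⟪g, (Ψ†)₊y⟫`. [folklore] [cite: Balaban1985BackgroundPropagators, (3.19) p.393] -/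
theorem inner_Psm_eq {Psdp : E → G} {Psm : G → E} (hPsdp : ∀ y, Psdp y = SG ((LinearMap.adjoint Ps) (Sinv y)))
    (hPsm : ∀ g, Psm g = (LinearMap.adjoint Sinv) (Ps ((LinearMap.adjoint SG) g))) (g : G) (y : E) : ⟪Psm g, y⟫_𝕜 = ⟪g, Psdp y⟫_𝕜 := by
  rw [hPsm, hPsdp, LinearMap.adjoint_inner_left Sinv, ← LinearMap.adjoint_inner_right Ps, LinearMap.adjoint_inner_left SG]

omit [FiniteDimensional 𝕜 B] in
/-- **(a) `(Ψ†)₊Q̃′†₊ = 1` DISCHARGED**: `Q̃′Ψ = 1`, `S⁻¹S = 1`, `S_GS_G⁻¹ = 1`, `Q̃′†₊h := S(Q̃′†(S_G⁻¹h))` (`W = S_G⁻¹`) ⇒ `(Ψ†)₊(Q̃′†₊h) = h`.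
[folklore] [cite: Balaban1985BackgroundPropagators, (3.19) p.393, (3.49) p.399] -/
theorem Psdp_Qdp_eq {Psdp : E → G} {Qdp : G → E} (hQPs : ∀ g, Q (Ps g) = g) (hSinvS : ∀ x, Sinv (S x) = x) (hSG' : ∀ v, SG (SGinv v) = v)
    (hPsdp : ∀ y, Psdp y = SG ((LinearMap.adjoint Ps) (Sinv y))) (hQdp : ∀ h, Qdp h = S ((LinearMap.adjoint Q) (SGinv h))) (h : G) :
    Psdp (Qdp h) = h := by
  have hadj : ∀ v, (LinearMap.adjoint Ps) ((LinearMap.adjoint Q) v) = v := by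
    intro v
    apply ext_inner_right 𝕜
    intro w
    rw [LinearMap.adjoint_inner_left, LinearMap.adjoint_inner_left, hQPs]
  rw [hPsdp, hQdp, hSinvS, hadj, hSG']

omit [FiniteDimensional 𝕜 G] [FiniteDimensional 𝕜 B] in
/-- A one-sided inverse passes to the adjoints: `S⁻¹S = 1 ⇒ S†((S⁻¹)†u) = u` (pairings only). [folklore] [cite: Balaban1985BackgroundPropagators, (3.49) p.399] -/
theorem adjoint_apply_adjoint_of_leftInverse (hSinvS : ∀ x, Sinv (S x) = x) (u : E) :
    (LinearMap.adjoint S) ((LinearMap.adjoint Sinv) u) = u := by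
  apply ext_inner_right 𝕜
  intro w
  rw [LinearMap.adjoint_inner_left, LinearMap.adjoint_inner_left, hSinvS]

/-- **THE `C_Ψ` LETTER IS ONE CONJUGATED LOCAL OPERATOR**: with `D₋f := (S_B⁻¹)†(D(S†f))`, `Q̃′₋f := (S_G⁻¹)†(Q̃′(S†f))` and `S⁻¹S = 1`, `S_G⁻¹S_G = 1`:
`D₋(Ψ₋(Q̃′₋y)) = (S_B⁻¹)†((DΨQ̃′)(S†y))`. [folklore] [cite: Balaban1985BackgroundPropagators, (3.49) p.399] -/
theorem Dm_Psm_Qm_eq {Dm : E → B} {Qm : E → G} {Psm : G → E} (hSinvS : ∀ x, Sinv (S x) = x) (hSG : ∀ v, SGinv (SG v) = v)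
    (hDm : ∀ f, Dm f = (LinearMap.adjoint SBinv) (D ((LinearMap.adjoint S) f))) (hQm : ∀ f, Qm f = (LinearMap.adjoint SGinv) (Q ((LinearMap.adjoint S) f)))
    (hPsm : ∀ g, Psm g = (LinearMap.adjoint Sinv) (Ps ((LinearMap.adjoint SG) g))) (y : E) :
    Dm (Psm (Qm y)) = (LinearMap.adjoint SBinv) (D (Ps (Q ((LinearMap.adjoint S) y)))) := by
  rw [hDm, hPsm, hQm, adjoint_apply_adjoint_of_leftInverse hSG, adjoint_apply_adjoint_of_leftInverse hSinvS]

/-- … so a norm letter for the conjugated local operator IS §1's `hCΨ`. [folklore] [cite: Balaban1985BackgroundPropagators, (3.49) p.399] -/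
theorem hCPsi_of_letter {Dm : E → B} {Qm : E → G} {Psm : G → E} (hSinvS : ∀ x, Sinv (S x) = x) (hSG : ∀ v, SGinv (SG v) = v)
    (hDm : ∀ f, Dm f = (LinearMap.adjoint SBinv) (D ((LinearMap.adjoint S) f))) (hQm : ∀ f, Qm f = (LinearMap.adjoint SGinv) (Q ((LinearMap.adjoint S) f)))
    (hPsm : ∀ g, Psm g = (LinearMap.adjoint Sinv) (Ps ((LinearMap.adjoint SG) g))) {CΨ : ℝ}
    (hL : ∀ u, ‖(LinearMap.adjoint SBinv) (D (Ps (Q ((LinearMap.adjoint S) u))))‖ ≤ CΨ * ‖u‖) (y : E) : ‖Dm (Psm (Qm y))‖ ≤ CΨ * ‖y‖ := by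
  rw [Dm_Psm_Qm_eq hSinvS hSG hDm hQm hPsm]; exact hL y

end Structure

/-! ## §3 The unconjugated corollary: (I2) on the range with one bump derivative, `κ₁`-free -/

section Unconjugated

variable [FiniteDimensional 𝕜 E] [FiniteDimensional 𝕜 G] [FiniteDimensional 𝕜 B]
  {D : E →ₗ[𝕜] B} {Q : E →ₗ[𝕜] G} {H : E →ₗ[𝕜] E} {A Ps : G →ₗ[𝕜] E} {a' : ℝ}

/-- On `ran A` (`H(Ag) = Q̃′†g`, `H = D†D + a′Q̃′†Q̃′`, `Q̃′Ψ = 1`, `‖DΨQ̃′‖ ≤ C_Ψ`, `‖Q̃′‖ ≤ M`): `‖D(Ag)‖ ≤ (C_Ψ + √a′·M)·‖Ag‖` — NO `κ₁`, NO injectivity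
of `A`, NO `‖Δ′_aΨ‖` (§1 at `S = 1`, `β = c = 0`). [folklore] [cite: Balaban1985BackgroundPropagators, (3.24)–(3.25) p.394, (3.49) p.399] -/
theorem norm_D_le_on_range_unconj (hH : ∀ f, H f = (LinearMap.adjoint D) (D f) + ((a' : ℝ) : 𝕜) • (LinearMap.adjoint Q) (Q f))
    (hHA : ∀ g, H (A g) = (LinearMap.adjoint Q) g) (hQPs : ∀ g, Q (Ps g) = g) (ha : 0 ≤ a') {CΨ M : ℝ} (hCΨ0 : 0 ≤ CΨ) (hM0 : 0 ≤ M)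
    (hCΨ : ∀ y, ‖D (Ps (Q y))‖ ≤ CΨ * ‖y‖) (hM : ∀ y, ‖Q y‖ ≤ M * ‖y‖) (g : G) :
    ‖D (A g)‖ ≤ (CΨ + Real.sqrt a' * M) * ‖A g‖ := by
  have hform : ∀ x y, ⟪x, H y⟫_𝕜 = ⟪D x, D y⟫_𝕜 + ((a' : ℝ) : 𝕜) * ⟪Q x, Q y⟫_𝕜 := by
    intro x y
    rw [hH, inner_add_right, inner_smul_right, LinearMap.adjoint_inner_right, LinearMap.adjoint_inner_right]
  have hHD : ∀ f, ‖D f‖ ^ 2 ≤ RCLike.re ⟪f, H f⟫_𝕜 := by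
    intro f
    rw [hform, map_add, RCLike.re_ofReal_mul, inner_self_eq_norm_sq (𝕜 := 𝕜), inner_self_eq_norm_sq (𝕜 := 𝕜)]
    nlinarith [mul_nonneg ha (sq_nonneg ‖Q f‖)]
  have hQdp : ∀ h z, ⟪(LinearMap.adjoint Q) h, z⟫_𝕜 = ⟪h, Q z⟫_𝕜 := fun h z => LinearMap.adjoint_inner_left Q z h
  have hPs : ∀ g y, ⟪Ps g, y⟫_𝕜 = ⟪g, (LinearMap.adjoint Ps) y⟫_𝕜 := fun g y => (LinearMap.adjoint_inner_right Ps g y).symm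
  have hPsQ : ∀ h, (LinearMap.adjoint Ps) ((LinearMap.adjoint Q) h) = h := by
    intro h
    apply ext_inner_right 𝕜
    intro w
    rw [LinearMap.adjoint_inner_left, LinearMap.adjoint_inner_left, hQPs]
  have h1 := norm_D_le_on_range_rinv (Dop := D) (Dp := D) (Dm := D) (Qp := Q) (Qm := Q) (H := H) (Hp := H) (Ap := A)
    (Qdp := (LinearMap.adjoint Q)) (Psm := Ps) (Psdp := (LinearMap.adjoint Ps)) hHD hform hHA hQdp hPs hPsQ ha hCΨ0 hM0 le_rfl le_rfl
    hCΨ hM hM (fun f => by simp) (fun y => by simp) g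
  have e : Real.sqrt (a' * M ^ 2 + CΨ * 0 + 0) = Real.sqrt a' * M := by rw [mul_zero, add_zero, add_zero, Real.sqrt_mul ha, Real.sqrt_sq hM0]
  calc ‖D (A g)‖ ≤ (CΨ + 2 * 0 + Real.sqrt (a' * M ^ 2 + CΨ * 0 + 0)) * ‖A g‖ := h1
    _ = (CΨ + Real.sqrt a' * M) * ‖A g‖ := by rw [e]; ring

end Unconjugated

/-! ## §4 Non-vacuity: §1's hypothesis set is jointly inhabited (identity maps on `𝕜`, `a′ = 0`, `C_Ψ = m = 1`, `β = c = 0`) -/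

/-- The conclusion then reads `‖h‖ ≤ (1 + 0 + √0)·‖h‖`. [folklore] [cite: Balaban1985BackgroundPropagators, (3.49) p.399] -/
example (h : 𝕜) : ‖id (id h)‖ ≤ (1 + 2 * 0 + Real.sqrt (0 * 1 ^ 2 + 1 * 0 + 0)) * ‖id h‖ :=
  norm_D_le_on_range_rinv (𝕜 := 𝕜) (E := 𝕜) (G := 𝕜) (B := 𝕜) (Dop := id) (Dp := id) (Dm := id) (Qp := id) (Qm := id) (H := id) (Hp := id) (Ap := id)
    (Qdp := id) (Psm := id) (Psdp := id) (a' := 0) (fun f => (inner_self_eq_norm_sq (𝕜 := 𝕜) f).symm.le) (fun x y => by simp) (fun _ => rfl) (fun _ _ => rfl)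
    (fun _ _ => rfl) (fun _ => rfl) le_rfl zero_le_one zero_le_one le_rfl le_rfl (fun y => by simp) (fun y => by simp) (fun y => by simp) (fun f => by simp)
    (fun y => by simp) h

end Literature.MathematicalPhysics.QuantumFieldTheory.Balaban1983to89.B9Eq349ConjugatedRangeEnergy
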